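import Mathlib
import Summits.QuantumFields.BalabanUV.Beta.AveragedContourChain

/-!
# Beta / AveragedContourChainLocal — THE LOCAL FORM of `AveragedContourChain.print_transport_defect_closed`: the
# (3.55) chain with AVERAGED legs of a site of the `j`-block, and the tree transport, depend only on the bond variables
# INSIDE THE `j`-BLOCK (b07's printed locality of (43), `B7Prop1Local.avgIter_congr`, BY NAME), so the plaquette
# hypothesis is needed on the `j`-block's own plaquettes only — residue (b) «locality ∕ covering» of the row-D4 census
# v3.31 §10.31 REMOVED for this input (unit `b2b-balaban-beta-an4`, row D4 OWNER, GEN 41; part 3 of the gen-41 item;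
# parts 1–2 = `AveragedBondUnrolling` p225113, `AveragedContourChain` p225797)

HONEST FRAMING: discharging `BetaPertH` makes Bałaban's UV stability UNCONDITIONAL — NOT the continuum limit, NOT the
Clay problem.  HONEST DEPENDENCY (verbatim): «continuum YM on T⁴ ⇐ BetaPertH ∧ nine spine estimates (0/9 proved);
BetaPertH ⇐ (D1) ∧ (D4) ∧ CAP+tail; G-an2-4 gates asym, D1 and NE2/3/4.»  THIS MODULE DISCHARGES NOTHING of `BetaPertH`,
asserts NOTHING printed and cites nothing as a fact (ABSOLUTE RULE): [folklore] bookkeeping on `ℤ^d` over the b07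
lineage's CERTIFIED terms and locality theorems for [B7] = `Balaban1985Averaging` ((43) p. 24 «this definition is local in
the sense that `Ū^k_c` … depends only on the bond variables `U_b` for `b ⊂ B^k(c₋) ∪ B^k(c₊)`» — kernel
`B7Prop1Local.avgIter_congr`; the clamped extension `clampCfg`, `pdevOn`, `pdev_clampCfg_le`, `hol_treeWord_congr` — all BY
NAME), following the template of b07's `prop2_local`.  [B9] = `Balaban1985BackgroundPropagators` (3.35) p. 396 («for an
arbitrary cube □ of the described above class … if the index of □ is j») and (3.55) p. 401 are LOCATORS; the plaquette
bound stays a HYPOTHESIS.  No class change on row D4 or G-B9-15 (width 0; D4 DISCHARGE NO DATE); NOT BetaPertH, NOT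
continuum, NOT Clay, NOT summit progress.

CONTENT (kernel, 0 sorry).  §1 the `j`-block box `[0, (L^j − 1)𝟙]` and the elementary inclusions: the leg endpoints
`L•x_{l+1}`, `x_l` lie in the `l`-lattice box `[0, (L^{j−l} − 1)𝟙]` and the averaging boxes `[L^l q, L^l q + (L^l − 1)𝟙
+ L^l e_κ]` of its bonds lie in the `j`-block.  §2 **`avgIter_agreeOn_block`** (fields agreeing on the `j`-block have
averaged fields `Ū^l` agreeing on the `l`-lattice box), **`leg_congr`**, **`chain_congr`**, `tree_congr`.  §3 **THE LOCAL
END `print_transport_defect_local`**: `print_transport_defect_closed` with `pdev U < α` replaced by `pdevOn 0 ((L^j − 1)𝟙) U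
< α` — the unit plaquettes INSIDE the `j`-block only (clamp, apply the global theorem to the clamped field, transfer by §2).
§4 non-vacuity.
-/

namespace Summit.QuantumFields.BalabanUV.Beta.AveragedContourChainLocal

open scoped BigOperators
open Finset
open Literature.MathematicalPhysics.QuantumFieldTheory.Balaban1983to89 B7Prop1Explicit B7Prop2Explicit B7Prop1Local
open Summit.QuantumFields.BalabanUV.Beta.AveragedBondUnrolling
open Summit.QuantumFields.BalabanUV.Beta.AveragedContourChain

variable {d : ℕ}

/-! ## §1 Boxes -/

/-- The upper corner `(L^m − 1)𝟙` of the box `[0, L^m)^d` (the `j`-block for `m = j` in fine coordinates; the block read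
on the `l`-lattice for `m = j − l`). [folklore] -/
def boxTop (L m : ℕ) : Site d := fun _ => (L : ℤ) ^ m - 1

/-- `⌊v∕L^l⌋ ≤ L^{j−l} − 1` for `v < L^j`, `l ≤ j` (integer form: `⌊v∕L^l⌋ + 1 ≤ L^{j−l}`). [folklore] -/
theorem qv_lt_of_lt (L : ℕ) (hL : 0 < L) {l j : ℕ} (hlj : l ≤ j) (v : Fin d → ℕ) (hv : ∀ i, v i < L ^ j)
    (i : Fin d) : qv L l v i + 1 ≤ (L : ℤ) ^ (j - l) := by
  have hpos : 0 < L ^ l := pow_pos hL l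
  have h1 : v i / L ^ l < L ^ (j - l) := by
    rw [Nat.div_lt_iff_lt_mul hpos, ← pow_add, Nat.sub_add_cancel hlj]
    exact hv i
  have h2 : ((v i / L ^ l : ℕ) : ℤ) + 1 ≤ ((L ^ (j - l) : ℕ) : ℤ) := by exact_mod_cast h1
  simpa [qv] using h2

/-- The leg endpoint `x_l` lies in the `l`-lattice box `[0, (L^{j−l} − 1)𝟙]`. [folklore] -/
theorem qv_inBox (L : ℕ) (hL : 0 < L) {l j : ℕ} (hlj : l ≤ j) (v : Fin d → ℕ) (hv : ∀ i, v i < L ^ j) :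
    InBox 0 (boxTop L (j - l)) (qv L l v) := fun i => by
  have h := qv_lt_of_lt L hL hlj v hv i
  refine ⟨?_, ?_⟩
  · show (0 : ℤ) ≤ ((v i / L ^ l : ℕ) : ℤ)
    exact Int.natCast_nonneg _
  · show qv L l v i ≤ (L : ℤ) ^ (j - l) - 1
    linarith

/-- The leg base point `L•x_{l+1}` lies in the `l`-lattice box `[0, (L^{j−l} − 1)𝟙]` (`l < j`). [folklore] -/
theorem smul_qv_inBox (L : ℕ) (hL : 0 < L) {l j : ℕ} (hlj : l < j) (v : Fin d → ℕ) (hv : ∀ i, v i < L ^ j) :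
    InBox 0 (boxTop L (j - l)) ((L : ℤ) • qv L (l + 1) v) := fun i => by
  have h := qv_lt_of_lt L hL hlj v hv i
  have h0 : (0 : ℤ) ≤ qv L (l + 1) v i := Int.natCast_nonneg _
  have hL0 : (0 : ℤ) ≤ L := Int.natCast_nonneg L
  refine ⟨?_, ?_⟩
  · show (0 : ℤ) ≤ (L : ℤ) * qv L (l + 1) v i
    exact mul_nonneg hL0 h0
  show (L : ℤ) * qv L (l + 1) v i ≤ (L : ℤ) ^ (j - l) - 1
  have hpow : (L : ℤ) ^ (j - l) = (L : ℤ) * (L : ℤ) ^ (j - (l + 1)) := by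
    rw [← pow_succ', show j - (l + 1) + 1 = j - l by omega]
  have h2 : (L : ℤ) * (qv L (l + 1) v i + 1) ≤ (L : ℤ) * (L : ℤ) ^ (j - (l + 1)) := mul_le_mul_of_nonneg_left h hL0
  have hL1 : (1 : ℤ) ≤ L := by exact_mod_cast hL
  nlinarith

/-! ## §2 Locality of the averaged legs and of the chain -/

section Local

variable {𝔸 : Type*} [NormedRing 𝔸] [NormOneClass 𝔸] [NormedAlgebra ℂ 𝔸] [CompleteSpace 𝔸]
variable (L : ℕ) {V V' : Site d → Fin d → 𝔸ˣ}

omit [NormOneClass 𝔸] in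
/-- **FIELDS AGREEING ON THE `j`-BLOCK HAVE AVERAGED FIELDS `Ū^l` AGREEING ON THE BLOCK'S `l`-BONDS** (`l ≤ j`): the
averaging box `[L^l q, L^l q + (L^l − 1)𝟙 + L^l e_κ]` of an `l`-bond of the block lies inside the `j`-block — b07's
`avgIter_congr` BY NAME. [cite: Balaban1985Averaging, p.24 (sentence after (43))] -/
theorem avgIter_agreeOn_block (hL : 1 ≤ L) {l j : ℕ} (hlj : l ≤ j) (h : AgreeOn 0 (boxTop L j) V V') :
    AgreeOn 0 (boxTop L (j - l)) (avgIter L V l) (avgIter L V' l) := by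
  intro q κ hq hqe
  refine avgIter_congr L hL l q κ (h.mono (fun i => ?_) (fun i => ?_))
  · have := (hq i).1
    simp only [loK, Pi.zero_apply] at this ⊢
    positivity
  · have hqi := (hq i).2
    have hqκ := (hqe κ).2
    simp only [boxTop, add_e_apply] at hqi hqκ
    have hpow : (L : ℤ) ^ j = (L : ℤ) ^ l * (L : ℤ) ^ (j - l) := by rw [← pow_add, Nat.add_sub_cancel' hlj]
    have hPl : (0 : ℤ) ≤ (L : ℤ) ^ l := by positivity
    simp only [bondHiK, boxTop]
    split_ifs with hi
    · subst hi
      have h1 : q i + 2 ≤ (L : ℤ) ^ (j - l) := by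
        simp only [if_true] at hqκ
        linarith
      have h2 : (L : ℤ) ^ l * (q i + 2) ≤ (L : ℤ) ^ l * (L : ℤ) ^ (j - l) := mul_le_mul_of_nonneg_left h1 hPl
      nlinarith
    · have h1 : q i + 1 ≤ (L : ℤ) ^ (j - l) := by linarith
      have h2 : (L : ℤ) ^ l * (q i + 1) ≤ (L : ℤ) ^ l * (L : ℤ) ^ (j - l) := mul_le_mul_of_nonneg_left h1 hPl
      nlinarith

omit [NormOneClass 𝔸] in
/-- **LOCALITY OF THE LEGS**: for `v` in the `j`-block and `l < j`, the leg `Ū^l(Γ_{x_{l+1},x_l})` depends only on the bond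
variables of the `j`-block. [cite: Balaban1985BackgroundPropagators, (3.55) p.401] -/
theorem leg_congr (hL : 1 ≤ L) {l j : ℕ} (hlj : l < j) (h : AgreeOn 0 (boxTop L j) V V') (v : Fin d → ℕ)
    (hv : ∀ i, v i < L ^ j) : leg L V l v = leg L V' l v := by
  have hL0 : 0 < L := hL
  unfold leg
  refine hol_treeWord_congr (avgIter_agreeOn_block L hL hlj.le h) _ _ (smul_qv_inBox L hL0 hlj v hv) ?_
  have hq : (L : ℤ) • qv L (l + 1) v + rv L l v = qv L l v := by rw [rv]; abel
  rw [hq]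
  exact qv_inBox L hL0 hlj.le v hv

omit [NormOneClass 𝔸] in
/-- **LOCALITY OF THE (3.55) CHAIN**: `U(Γ^{(j)}_{0,v})` depends only on the bond variables of the `j`-block. [folklore] -/
theorem chain_congr (hL : 1 ≤ L) {j : ℕ} (h : AgreeOn 0 (boxTop L j) V V') (v : Fin d → ℕ) (hv : ∀ i, v i < L ^ j) :
    ∀ m ≤ j, chain L V m v = chain L V' m v
  | 0, _ => by simp
  | m + 1, hm => by
    rw [chain_succ, chain_succ, leg_congr L hL (Nat.lt_of_succ_le hm) h v hv,
      chain_congr hL h v hv m (Nat.le_of_succ_le hm)]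

omit [NormOneClass 𝔸] [NormedAlgebra ℂ 𝔸] [CompleteSpace 𝔸] in
/-- Locality of the tree transport from the base point to `v`. [folklore] -/
theorem tree_congr (hL : 1 ≤ L) {j : ℕ} (h : AgreeOn 0 (boxTop L j) V V') (v : Fin d → ℕ) (hv : ∀ i, v i < L ^ j) :
    hol V 0 (treeWord (natVec v)) = hol V' 0 (treeWord (natVec v)) := by
  have h0 : InBox 0 (boxTop L j) (0 : Site d) := fun i => by
    simp only [Pi.zero_apply, boxTop, le_refl, true_and, sub_nonneg]
    exact_mod_cast Nat.one_le_pow j L hL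
  refine hol_treeWord_congr h 0 _ h0 ?_
  rw [zero_add, ← qv_zero L]
  simpa using qv_inBox L hL (Nat.zero_le j) v hv

/-! ## §3 THE LOCAL END -/

/-- **PRINT'S TRANSPORT AGAINST THE TREE TRANSPORT FROM THE `j`-BLOCK'S OWN PLAQUETTES.**  As
`AveragedContourChain.print_transport_defect_closed`, but with the plaquette hypothesis ON THE `j`-BLOCK ONLY:
`pdevOn 0 ((L^j − 1)𝟙) U < α` (every unit plaquette with all four corners in `[0, L^j − 1]^d`) ⟹ for every `v` in the block
`‖U(treeWord v)·U(Γ^{(j)}_{0,v})⁻¹ − 1‖ ≤ C(|v|₁, 2)·α + 64·d(d+1)²·(αL^{2j})∕(L+1)`.  Proof: clamp `U` outside the block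
(b07 `clampCfg`: global deviation ≤ the deviation inside, `G`-valued), apply the global theorem, transfer by §2.  In print
(3.35) is imposed on a cube □ ⊃ B^j(y) — so its plaquette consequence is available on the block's own plaquettes, which is
all this END consumes. [cite: Balaban1985BackgroundPropagators, (3.35) p.396, (3.55) p.401]
[cite: Balaban1985Averaging, p.24 (sentence after (43)), p.26 (sentence after (54))] -/
theorem print_transport_defect_local (hL : 2 ≤ L) {G : Subgroup 𝔸ˣ} (hG : AvgClosed d L G) (V : Site d → Fin d → 𝔸ˣ)
    (hVG : ∀ x κ, V x κ ∈ G) {α : ℝ} (hα : 0 < α) (j : ℕ) (h52 : pdevOn 0 (boxTop L j) V < α)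
    (hreg : ∀ m < j, C0 d * (α * ((L : ℝ) ^ m) ^ 2) ≤ 1 / 3 ∧ 2 * (α * ((L : ℝ) ^ m) ^ 2) ≤ c2' d L)
    (hlog : ∀ m < j, (2 * ((d : ℝ) + 1) * L) ^ 2 * (2 * (α * ((L : ℝ) ^ m) ^ 2)) ≤ 1 / 2)
    (v : Fin d → ℕ) (hv : ∀ i, v i < L ^ j) :
    ‖((hol V 0 (treeWord (natVec v)) * (chain L V j v)⁻¹ : 𝔸ˣ) : 𝔸) - 1‖ ≤
      ((l1 (natVec v)).choose 2 : ℕ) * α +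
        64 * d * ((d : ℝ) + 1) ^ 2 * (α * ((L : ℝ) ^ j) ^ 2) / ((L : ℝ) + 1) := by
  have hL1 : 1 ≤ L := le_trans (by norm_num) hL
  have hlohi : ∀ i, (0 : Site d) i ≤ boxTop L j i := fun i => by
    simp only [Pi.zero_apply, boxTop, sub_nonneg]
    exact_mod_cast Nat.one_le_pow j L hL1
  set V' : Site d → Fin d → 𝔸ˣ := clampCfg 0 (boxTop L j) V with hV'
  have hV'G : ∀ x κ, V' x κ ∈ G := clampCfg_mem hVG
  have hVU : ∀ x κ, V x κ ∈ U1 𝔸 := fun x κ => hG.le_U1 (hVG x κ)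
  have h52' : pdev V' < α := (pdev_clampCfg_le hlohi hVU).trans_lt h52
  have hagree : AgreeOn 0 (boxTop L j) V' V := clampCfg_agree V
  have h := print_transport_defect_closed L V' hL hG hV'G hα h52' j hreg hlog v hv
  rw [tree_congr L hL1 hagree v hv, chain_congr L hL1 hagree v hv j le_rfl] at h
  exact h

end Local

/-! ## §4 Non-vacuity -/

section NonVacuity

open scoped Matrix.Norms.L2Operator

/-- For the flat configuration every leg is a product of averaged bond variables of the flat field; at depth `j = 0`
the chain is `1` and the two fields `V`, `V′ = V` trivially agree, so `chain_congr` returns `rfl`-equal chains. [folklore] -/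
example (v : Fin 2 → ℕ) (hv : ∀ i, v i < 2 ^ 3) :
    chain 2 (fun (_ : Site 2) (_ : Fin 2) => (1 : (Matrix (Fin 2) (Fin 2) ℂ)ˣ)) 3 v =
      chain 2 (fun (_ : Site 2) (_ : Fin 2) => (1 : (Matrix (Fin 2) (Fin 2) ℂ)ˣ)) 3 v :=
  chain_congr 2 (by norm_num) (fun _ _ _ _ => rfl) v hv 3 le_rfl

end NonVacuity

end Summit.QuantumFields.BalabanUV.Beta.AveragedContourChainLocal
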